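import Literature.MathematicalPhysics.QuantumFieldTheory.Balaban1983to89.B12FaddeevPopov016
import Literature.MathematicalPhysics.QuantumFieldTheory.Balaban1983to89.MissingProofs

/-!
# BalabanUVNodes ∕ N13 — GAUGING AWAY A TARGET-DISJOINT BOND FAMILY ON BAŁABAN'S CARRIER: the Faddeev–Popov identity with indicator weights, and the even-`x₀` direction-0 matching

(Track A, DAG node N13 = [B16]; cluster K1 — K1⁹ `StabilityBRunRowsAtRecordR13SepCoPHV` = stmt-QuantumFields-27364, helper; seat `pub-ymgap-dag-n13-w3` g5; 2026-08-28;
count-neutral.)  First of the files deciding the «numerics question» this seat's p625602 (`…N13NormalisationWindowOfCor3AtRecord13SepCoPHV`) located and left open: whether a Stage-13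
witness whose normalisation inputs `logz`, `Efl` are COUPLING-BLIND (the tree's K0-class witnesses read `Efl = logz = 0`) can carry (B)'s Cor-3 conjunct.  This file is the measure-theoretic
engine of the analytic half (the companion `…N13WilsonPartitionFnGaugeFixedLowerBound` turns it into `log Z_{T^{(0)}}(β) ≥ −(7∕4)(N²−1)|T₁^{(0)}| log β − C|T₁^{(0)}|`).

WHAT IS PROVED ([folklore] measure theory over the tree's `Setup.fieldMeasure`, `GaugeField.gaugeAct`, `Missing.boltzmann ∕ partitionFn`; 0 `sorry`, 0 `def`):
* §0 `gaugeInvariant_boltzmann` — the Wilson weight `e^{−βA}` is gauge invariant (re-derived; tree twin `T4WilsonGaugeFlatDirection.wilsonAction_gaugeAct`, not imported to keep this leaf light).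
* §1 ★★ `pow_mul_integral_eq_integral_mul_prod_indicator_of_gaugeInvariant` — THE FADDEEV–POPOV IDENTITY FOR A TARGET-DISJOINT BOND FAMILY: for a finset `M` of bonds no source of which is a
  target of `M` and on which `tgt` is injective, every measurable `B ⊆ G` and every gauge-invariant integrable `F`:  `haar(B)^{|M|} · ∫ F dU = ∫ F(U)·Π_{b∈M} 1_B(U(b)) dU` — constraining the
  `M`-bonds under a gauge-invariant weight costs EXACTLY `haar(B)^{|M|}`.  Proof = print's (0.15)∕(0.16) road ([Balaban1987RG1] pp.254–255; tree `B12FaddeevPopov016`) with the δ-free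
  weight `1_B`: insert `haar(B) = ∫ 1_B(U(b)·u) du` per bond (Haar invariance), Fubini, gauge-transform by `h(tgt b) = u_b⁻¹` (`= 1` elsewhere), invariance of `F` and of `dU`
  (`B12FaddeevPopov016.integral_comp_gaugeAct`); `pow_mul_partitionFn_eq` = the same at `F = e^{−βA}`.
* §2 `exists_targetDisjoint_matching` — on every torus `T^{(j)}` (`sitesPerDir j = 2L^{m+K−j}` is even) the direction-`0` bonds issued from the sites with even `0`-coordinate form a
  target-disjoint, `tgt`-injective family `M₀` with `2·|M₀| = |T₁^{(j)}|`.
HONEST FRAMING: elementary; nothing of Bałaban's asserted or refuted; no skeleton ∕ route text touched; N13 NOT discharged; K1⁹ NEITHER proved NOR refuted; counts UNMOVED (typed 28∕28 ·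
discharged 5∕27 · A 5∕28); R4 closes the conditional finite-𝕋⁴ rung `BalabanLadder.UV` only — the Yang–Mills mass gap (Clay) is NOT proved by any of this; nothing continuum ∕ ℝ⁴ ∕ OS.
No `sorry`, `def`, `instance`, `notation`.
-/

noncomputable section

open MeasureTheory
open scoped BigOperators

namespace Summit.QuantumFields.YangMills.BalabanUVNodes.N13GaugeFixingTargetDisjointBondFamily

open Literature.MathematicalPhysics.QuantumFieldTheory.Balaban1983to89
open Missing

/-! ## §0. Gauge invariance of the Wilson weight (re-derived to keep imports small; tree twin `T4WilsonGaugeFlatDirection.wilsonAction_gaugeAct`) -/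

section GaugeInv

variable {P : Params} {j : ℕ} {G : Type*} [GaugeGroup G]

/-- Unit shifts commute on the torus. [folklore] -/
private theorem shift_comm (x : Site P j) (μ ν : Fin P.d) : (x.shift μ).shift ν = (x.shift ν).shift μ := by
  funext κ
  by_cases hκν : κ = ν
  · subst hκν
    by_cases hκμ : κ = μ
    · subst hκμ; rfl
    · simp [Site.shift, Function.update_apply, hκμ]
  · by_cases hκμ : κ = μ
    · subst hκμ
      simp [Site.shift, Function.update_apply, hκν]
    · simp [Site.shift, Function.update_apply, hκμ, hκν]

/-- `U^u(∂p) = u(p₋)·U(∂p)·u(p₋)⁻¹`. [cite: Balaban1985Averaging, (9) p.19 (bookkeeping)] -/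
private theorem plaqHol_gaugeAct (u : GaugeTransf P j G) (U : GaugeField P j G) (p : Plaq P j) :
    GaugeField.plaqHol (GaugeField.gaugeAct u U) p = u p.src * GaugeField.plaqHol U p * (u p.src)⁻¹ := by
  simp only [GaugeField.plaqHol, GaugeField.gaugeAct, PBond.tgt, shift_comm p.src p.ν p.μ]
  group

/-- `A(U^u) = A(U)` for the unit-weight Wilson action. [cite: Balaban1987RG1, (0.2) p.252 (bookkeeping)] -/
private theorem wilsonAction4_gaugeAct (u : GaugeTransf P j G) (U : GaugeField P j G) :
    wilsonAction4 (GaugeField.gaugeAct u U) = wilsonAction4 U := by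
  unfold wilsonAction4 wilsonAction
  exact Finset.sum_congr rfl fun p _ => by rw [plaqHol_gaugeAct, GaugeGroup.reTr_conj]

/-- The Boltzmann weight `e^{−βA}` is gauge invariant. [cite: Balaban1985Averaging, (12) p.19 (bookkeeping)] -/
theorem gaugeInvariant_boltzmann (P : Params) (β : ℝ) : GaugeField.GaugeInvariant (boltzmann (G := G) P β) :=
  fun u U => by rw [boltzmann, boltzmann, wilsonAction4_gaugeAct]

end GaugeInv

/-! ## §1. The Faddeev–Popov identity for a target-disjoint bond family -/

section FaddeevPopov

variable {P : Params} {j : ℕ} {G : Type*} [GaugeGroup G] [MeasurableSpace G] [HaarData G] [MeasurableMul₂ G]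

/-- One bond: `∫ 1_B(w·u) du = haar(B)` (left invariance of the Haar datum). [folklore] -/
theorem integral_indicator_mul_left_eq_haarReal {B : Set G} (hB : MeasurableSet B) (w : G) :
    ∫ u, B.indicator (fun _ => (1 : ℝ)) (w * u) ∂(HaarData.haar : Measure G) = (HaarData.haar : Measure G).real B := by
  let e : G ≃ᵐ G := MeasurableEquiv.mulLeft w
  have he : ∀ u, e u = w * u := fun u => rfl
  have hmp : MeasurePreserving e (HaarData.haar : Measure G) (HaarData.haar : Measure G) := by
    refine ⟨e.measurable, ?_⟩
    have h1 : (e : G → G) = fun u : G => w * u := by funext u; rfl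
    rw [h1, HaarData.map_mul_left]
  have := hmp.integral_comp' (fun v : G => B.indicator (fun _ => (1 : ℝ)) v)
  simp only [he] at this
  rw [this]
  exact integral_indicator_one hB

/-- **★★ THE FADDEEV–POPOV IDENTITY FOR A TARGET-DISJOINT BOND FAMILY.**  Let `M` be a finset of bonds of `T^{(j)}` such that no SOURCE of a bond of
`M` is the TARGET of a bond of `M` and `tgt` is injective on `M`; let `B ⊆ G` be measurable and `F` gauge invariant and integrable.  Then
`haar(B)^{|M|} · ∫ F dU = ∫ F(U) · Π_{b∈M} 1_B(U(b)) dU`: constraining the `M`-bonds to `B` under a gauge-invariant weight costs EXACTLY `haar(B)^{|M|}` —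
the bonds of `M` can be gauged away.  Print's Faddeev–Popov road (0.15)∕(0.16) with indicator weights. [cite: Balaban1987RG1, (0.15)–(0.16) pp.254–255] -/
theorem pow_mul_integral_eq_integral_mul_prod_indicator_of_gaugeInvariant (M : Finset (PBond P j))
    (hsrc : ∀ b ∈ M, ∀ b' ∈ M, b'.tgt ≠ b.src) (hinj : Set.InjOn PBond.tgt (M : Set (PBond P j)))
    {B : Set G} (hB : MeasurableSet B) {F : GaugeField P j G → ℝ} (hF : GaugeField.GaugeInvariant F)
    (hFi : Integrable F (fieldMeasure P j G)) :
    (HaarData.haar : Measure G).real B ^ M.card * ∫ U, F U ∂(fieldMeasure P j G) =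
      ∫ U, F U * ∏ b ∈ M, B.indicator (fun _ => (1 : ℝ)) (U b) ∂(fieldMeasure P j G) := by
  classical
  set c : ℝ := (HaarData.haar : Measure G).real B with hc
  set η : Measure (M → G) := Measure.pi fun _ => (HaarData.haar : Measure G) with hη
  -- the doubled integrand
  set Φ : GaugeField P j G → (M → G) → ℝ := fun U u => F U * ∏ b : M, B.indicator (fun _ => (1 : ℝ)) (U b * u b) with hΦ
  -- Step 1: for every `U`, the `u`-integral of the product is `c^{|M|}`
  have h1 : ∀ U : GaugeField P j G, ∫ u, (∏ b : M, B.indicator (fun _ => (1 : ℝ)) (U b * u b)) ∂η = c ^ M.card := by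
    intro U
    rw [hη, integral_fintype_prod_eq_prod (fun (b : M) (w : G) => B.indicator (fun _ => (1 : ℝ)) (U b * w))]
    simp_rw [integral_indicator_mul_left_eq_haarReal hB]
    rw [Finset.prod_const, Finset.card_univ, Fintype.card_coe]
  -- Step 2: `c^{|M|} ∫ F = ∫ dU ∫ dη Φ`
  have h2 : c ^ M.card * ∫ U, F U ∂(fieldMeasure P j G) = ∫ U, ∫ u, Φ U u ∂η ∂(fieldMeasure P j G) := by
    rw [← integral_const_mul]
    refine integral_congr_ae (Filter.Eventually.of_forall fun U => ?_)
    simp only [hΦ]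
    rw [integral_const_mul, h1 U, mul_comm]
  -- Step 3: Fubini
  have hΦ_int : Integrable (Function.uncurry Φ) ((fieldMeasure P j G).prod η) := by
    have ha : Integrable (fun p : GaugeField P j G × (M → G) => F p.1) ((fieldMeasure P j G).prod η) := hFi.comp_fst η
    have hb_meas : Measurable (fun p : GaugeField P j G × (M → G) => ∏ b : M, B.indicator (fun _ => (1 : ℝ)) (p.1 b * p.2 b)) := by
      refine Finset.measurable_prod _ fun b _ => ?_
      have hm1 : Measurable fun p : GaugeField P j G × (M → G) => p.1 (b : PBond P j) :=
        (measurable_pi_apply (b : PBond P j)).comp measurable_fst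
      have hm2 : Measurable fun p : GaugeField P j G × (M → G) => p.2 b := (measurable_pi_apply b).comp measurable_snd
      exact (measurable_const.indicator hB).comp (hm1.mul hm2)
    have hb_bdd : ∀ p : GaugeField P j G × (M → G), ‖∏ b : M, B.indicator (fun _ => (1 : ℝ)) (p.1 b * p.2 b)‖ ≤ 1 := by
      intro p
      rw [Real.norm_eq_abs, Finset.abs_prod]
      refine Finset.prod_le_one (fun b _ => abs_nonneg _) fun b _ => ?_
      rw [abs_of_nonneg (Set.indicator_nonneg (fun _ _ => zero_le_one) _)]
      exact Set.indicator_le_self' (fun _ _ => zero_le_one) _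
    have h := ha.bdd_mul hb_meas.aestronglyMeasurable (Filter.Eventually.of_forall hb_bdd)
    refine h.congr (Filter.Eventually.of_forall fun p => ?_)
    simp only [hΦ, Function.uncurry]
    ring
  rw [h2, integral_integral_swap hΦ_int]
  -- Step 4: for fixed `u`, gauge-transform `U` by `h_u` (`h_u(tgt b) = u_b⁻¹`, `= 1` elsewhere): the inner integral loses `u`
  have h4 : ∀ u : M → G, ∫ U, Φ U u ∂(fieldMeasure P j G) = ∫ U, F U * ∏ b ∈ M, B.indicator (fun _ => (1 : ℝ)) (U b) ∂(fieldMeasure P j G) := by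
    intro u
    -- the gauge transformation
    let hu : GaugeTransf P j G := fun y => if hy : ∃ b, b ∈ M ∧ PBond.tgt b = y then (u ⟨Classical.choose hy, (Classical.choose_spec hy).1⟩)⁻¹ else 1
    have hsrc1 : ∀ b ∈ M, hu b.src = 1 := by
      intro b hb
      have hne : ¬ ∃ b', b' ∈ M ∧ PBond.tgt b' = b.src := fun ⟨b', hb', he⟩ => hsrc b hb b' hb' he
      simp only [hu, dif_neg hne]
    have htgt1 : ∀ (b : PBond P j) (hb : b ∈ M), hu b.tgt = (u ⟨b, hb⟩)⁻¹ := by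
      intro b hb
      have hex : ∃ b', b' ∈ M ∧ PBond.tgt b' = b.tgt := ⟨b, hb, rfl⟩
      simp only [hu, dif_pos hex]
      have hb' : Classical.choose hex = b :=
        hinj (Classical.choose_spec hex).1 hb (Classical.choose_spec hex).2
      congr 2
      exact Subtype.ext hb'
    have hact : ∀ (U : GaugeField P j G) (b : PBond P j) (hb : b ∈ M), GaugeField.gaugeAct hu U b = U b * u ⟨b, hb⟩ := by
      intro U b hb
      simp only [GaugeField.gaugeAct, hsrc1 b hb, htgt1 b hb, one_mul, inv_inv]
    have hpt : ∀ U : GaugeField P j G, Φ U u =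
        (fun W : GaugeField P j G => F W * ∏ b ∈ M, B.indicator (fun _ => (1 : ℝ)) (W b)) (GaugeField.gaugeAct hu U) := by
      intro U
      simp only [hΦ]
      rw [hF hu U, ← Finset.prod_coe_sort M]
      congr 1
      exact Finset.prod_congr rfl fun b _ => by rw [hact U b b.2]
    simp_rw [hpt]
    exact B12FaddeevPopov016.integral_comp_gaugeAct hu (fun W : GaugeField P j G => F W * ∏ b ∈ M, B.indicator (fun _ => (1 : ℝ)) (W b))
  simp_rw [h4]
  rw [integral_const, hη]
  simp

end FaddeevPopov

/-! ## §2. The even-`x₀` direction-0 matching -/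

section Matching

variable (P : Params) (j : ℕ)

/-- **A TARGET-DISJOINT MATCHING COVERING HALF THE SITES.**  On every torus `T^{(j)}` of `P` (its side `2L^{m+K−j}` is even) there is a finset `M` of bonds —
the direction-`0` bonds issued from the sites with EVEN `0`-coordinate — such that no source of `M` is a target of `M`, `tgt` is injective on `M`, and
`2·|M| = |T₁^{(j)}|`. [folklore] -/
theorem exists_targetDisjoint_matching :
    ∃ M : Finset (PBond P j), (∀ b ∈ M, ∀ b' ∈ M, b'.tgt ≠ b.src) ∧ Set.InjOn PBond.tgt (M : Set (PBond P j)) ∧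
      2 * M.card = Fintype.card (Site P j) := by
  classical
  have h2 : 2 ∣ P.sitesPerDir j := by unfold Params.sitesPerDir; exact dvd_mul_right 2 _
  let ε : ZMod (P.sitesPerDir j) →+* ZMod 2 := ZMod.castHom h2 (ZMod 2)
  let i0 : Fin P.d := ⟨0, P.hd⟩
  let E : Finset (Site P j) := Finset.univ.filter fun x => ε (x i0) = 0
  let emb : Site P j ↪ PBond P j := ⟨fun x => ⟨x, i0⟩, fun x y h => by cases h; rfl⟩
  have hmem : ∀ {b : PBond P j}, b ∈ E.map emb → b.dir = i0 ∧ ε (b.src i0) = 0 := by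
    intro b hb
    obtain ⟨x, hx, rfl⟩ := Finset.mem_map.1 hb
    exact ⟨rfl, (Finset.mem_filter.1 hx).2⟩
  have hshift_self : ∀ x : Site P j, (x.shift i0) i0 = x i0 + 1 := fun x => by simp [Site.shift]
  have hshift_ne : ∀ (x : Site P j) (κ : Fin P.d), κ ≠ i0 → (x.shift i0) κ = x κ := fun x κ hκ => by simp [Site.shift, hκ]
  have hz2 : ∀ a : ZMod 2, a ≠ 0 → a = 1 := by decide
  refine ⟨E.map emb, ?_, ?_, ?_⟩
  · -- no source of `M` is a target of `M`: parities differ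
    intro b hb b' hb' heq
    obtain ⟨hbd, hbε⟩ := hmem hb
    obtain ⟨hb'd, hb'ε⟩ := hmem hb'
    have h1 : b.src i0 = b'.src i0 + 1 := by
      rw [← heq, PBond.tgt, hb'd, hshift_self]
    have : ε (b.src i0) = 1 := by rw [h1, map_add, map_one, hb'ε, zero_add]
    rw [hbε] at this
    exact zero_ne_one this
  · -- `tgt` is injective on `M`
    intro b hb b' hb' heq
    obtain ⟨hbd, -⟩ := hmem hb
    obtain ⟨hb'd, -⟩ := hmem hb'
    have hs : b.src = b'.src := by
      funext κ
      have hκ := congrFun heq κ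
      simp only [PBond.tgt, hbd, hb'd] at hκ
      by_cases h : κ = i0
      · subst h; rwa [hshift_self, hshift_self, add_left_inj] at hκ
      · rwa [hshift_ne _ _ h, hshift_ne _ _ h] at hκ
    cases b; cases b'
    simp only at hs hbd hb'd
    subst hs; subst hbd; subst hb'd; rfl
  · -- `2·|M| = |T|`: the parity classes are in bijection by `x ↦ x + e₀`
    rw [Finset.card_map]
    let E' : Finset (Site P j) := Finset.univ.filter fun x => ¬ ε (x i0) = 0
    have hEE' : E.card = E'.card := by
      refine Finset.card_bij' (fun x _ => Function.update x i0 (x i0 + 1)) (fun x _ => Function.update x i0 (x i0 - 1))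
        ?_ ?_ ?_ ?_
      · intro x hx
        have hx0 : ε (x i0) = 0 := (Finset.mem_filter.1 hx).2
        refine Finset.mem_filter.2 ⟨Finset.mem_univ _, ?_⟩
        rw [Function.update_self, map_add, map_one, hx0, zero_add]
        exact one_ne_zero
      · intro x hx
        have hx0 : ε (x i0) = 1 := hz2 _ (Finset.mem_filter.1 hx).2
        refine Finset.mem_filter.2 ⟨Finset.mem_univ _, ?_⟩
        rw [Function.update_self, map_sub, map_one, hx0, sub_self]
      · intro x hx
        funext κ
        by_cases h : κ = i0
        · subst h; simp
        · simp [h]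
      · intro x hx
        funext κ
        by_cases h : κ = i0
        · subst h; simp
        · simp [h]
    have hsum : E.card + E'.card = Fintype.card (Site P j) := by
      rw [← Finset.card_univ]
      exact Finset.card_filter_add_card_filter_not _
    omega

end Matching

/-! ## §3. The identity at the Boltzmann weight -/

section Boltzmann

/-- **THE MATCHING GAUGE FOR `Z`**: for every target-disjoint bond family `M`, every measurable `B` and `β ≥ 0`, `haar(B)^{|M|}·Z_P(β) = ∫ e^{−βA}·Π_{b∈M} 1_B(U(b)) dU`
(§1 at the gauge-invariant Boltzmann weight). [cite: Balaban1987RG1, (0.15)–(0.16) pp.254–255 (bookkeeping)] -/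
theorem pow_mul_partitionFn_eq {G : Type*} [GaugeGroup G] [MeasurableSpace G] [HaarData G] [RegularGaugeGroup G]
    (P : Params) (M : Finset (PBond P 0)) (hsrc : ∀ b ∈ M, ∀ b' ∈ M, b'.tgt ≠ b.src) (hinj : Set.InjOn PBond.tgt (M : Set (PBond P 0)))
    {B : Set G} (hB : MeasurableSet B) {β : ℝ} (hβ : 0 ≤ β) :
    (HaarData.haar : Measure G).real B ^ M.card * partitionFn (G := G) P β =
      ∫ U, boltzmann P β U * ∏ b ∈ M, B.indicator (fun _ => (1 : ℝ)) (U b) ∂(fieldMeasure P 0 G) :=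
  pow_mul_integral_eq_integral_mul_prod_indicator_of_gaugeInvariant M hsrc hinj hB (gaugeInvariant_boltzmann P β)
    (integrable_boltzmann RegularGaugeGroup.measurable_reTr P hβ)

end Boltzmann

end Summit.QuantumFields.YangMills.BalabanUVNodes.N13GaugeFixingTargetDisjointBondFamily

end
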